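import Summits.Ventures.CertifiedManyBodySolver.Downfold.PressureAxisEOS
import HarnessLib

/-!
# The (b)-margin and guard tests on the PRESSURE axis, and the P-INTERVALS rows re-certified from
# the EOS inputs they print

Venture CertifiedManyBodySolver, cell `pub/hubbard-downfold` (S1 = downfolding front end = ROUTER),
seat hubbard-downfold-mod-2; namespace `Summit.Ventures.CertifiedManyBodySolver.Downfold.Inflation`.
Companion of `PressureAxisEOS` (§1 spacing from a modulus floor / ceiling, §2 the Murnaghan closed
form `murnaghanStrain` with the two-point spacing rule). Here:

* §3 THE DECISIONS ON THE PRESSURE AXIS: `exp_lt_on_pressure_Icc_of_expUB_test` (two-sided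
  (b)-margin test of `PressureAxisDecide` composed with a monotone log-compression law `c` and ANY
  certified spacing bound `c(P₂) - c(P₁) ≤ Lbar`), `lt_exp_on_pressure_Icc_of_linear_test` (lower
  guard), `exp_lt_on_pressure_Icc_of_expUB_end_test` (one-sided reach upward from the last computed
  point), the right-end variant `exp_lt_on_Icc_of_expUB_right_end_test` /
  `exp_lt_on_pressure_Icc_of_expUB_start_test` (reach downward from the first computed point), and
  the all-in-one `exp_lt_on_pressure_Icc_of_modulusFloor_test` (only EOS input: a modulus floor
  `K_min` on the sub-interval) / `exp_lt_on_pressure_Icc_of_murnaghan_test` (only EOS input: the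
  printed `(B₀, B₀')`, spacing bound `(P₂ - P₁)/(B₀ + B₀' P₁)`).
* §4 ROWS OF RECORD RE-CERTIFIED FROM THE EOS INPUTS THEY PRINT (no floating-point `L`):
  V M102 (30,60) / (60,90) / (90,120) decided and (0,30) withheld on the Murnaghan-class inputs
  `K₀ 157 GPa, K′ 3.5` of the row (`router/P-INTERVALS.md` V M102); the R-dq pre-registration
  V (0,10) decided with the EOS-SHAPE-FREE floor `L ≤ 10/157` (any law with `K ≥ K₀` on `[0, 10]`);
  Y M99 (46.6,89.3) decided on `K₀ 41, K′ 2.8` in ONE step (`L ≤ 42.7/171.48`; the row's floating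
  value was 0.189).

* §5 THE SECANT RULE for reaches without a printed EOS: a CONCAVE log-compression law (modulus
  non-softening) has spacing beyond the last point at most width × own-secant rate
  (`strain_sub_le_mul_slope_of_concaveOn`; concavity from an antitone derivative,
  `murnaghanStrain_concaveOn`); a reach inside a computed pair needs only monotonicity; reaches of
  record re-certified (Pb 10 → 13.7, Lu–N–H 1 → 6, Y 89.3 → 100 with the guard, CaH₆ 170 → 160 by
  the EOS-free floor).

Everything is PROVED. WHAT THIS IS NOT: a claim about any material — `S = 12/5`, the guards
`r_man,hi`, the threshold `θ_c3 = 3/5` and the EOS parameters are SYSTEMATIC (screening-grade)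
inputs of the rows; a passing test certifies the implication «inputs ⇒ word on the pressure
sub-interval», a withheld row certifies only that this test does not give the word.
-/

open Set

namespace Summit.Ventures.CertifiedManyBodySolver.Downfold

namespace Inflation

/-! ## §3 The margin and guard tests stated on the PRESSURE axis -/

/-- **THE (b)-MARGIN DECISION ON A PRESSURE SUB-INTERVAL.** `c` monotone on `[P₁, P₂]` with a
certified spacing bound `c(P₂) - c(P₁) ≤ Lbar`; `X = exp ∘ f` along the log-compression axis with
`|f'| ≤ S` (`0 ≤ S`) between the two end compressions; end values `X(P₁) ≤ h₁`, `X(P₂) ≤ h₂`;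
`S·Lbar/2 ≤ 1` and the rational test `max h₁ h₂ · expUB (S·Lbar/2) < θ` ⇒ `X < θ` at EVERY pressure
of `[P₁, P₂]`. [folklore] -/
theorem exp_lt_on_pressure_Icc_of_expUB_test {c f f' : ℝ → ℝ} {P₁ P₂ Lbar S h₁ h₂ θ P : ℝ}
    (hc : MonotoneOn c (Icc P₁ P₂)) (hL : c P₂ - c P₁ ≤ Lbar)
    (hcont : ContinuousOn f (Icc (c P₁) (c P₂)))
    (hder : ∀ x ∈ Ioo (c P₁) (c P₂), HasDerivAt f (f' x) x)
    (hS : ∀ x ∈ Ioo (c P₁) (c P₂), |f' x| ≤ S) (hS0 : 0 ≤ S) (h12 : P₁ ≤ P₂)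
    (hx1 : S * (Lbar / 2) ≤ 1) (h1 : Real.exp (f (c P₁)) ≤ h₁) (h2 : Real.exp (f (c P₂)) ≤ h₂)
    (htest : max h₁ h₂ * expUB (S * (Lbar / 2)) < θ) (hP : P ∈ Icc P₁ P₂) :
    Real.exp (f (c P)) < θ := by
  have hu : c P ∈ Icc (c P₁) (c P₂) := mem_Icc_of_monotoneOn hc hP
  have hab : c P₁ ≤ c P₂ := hc (left_mem_Icc.2 h12) (right_mem_Icc.2 h12) h12
  have hpad0 : 0 ≤ S * ((c P₂ - c P₁) / 2) := mul_nonneg hS0 (by linarith)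
  have hpad : S * ((c P₂ - c P₁) / 2) ≤ S * (Lbar / 2) :=
    mul_le_mul_of_nonneg_left (by linarith) hS0
  have hh : 0 ≤ max h₁ h₂ := ((Real.exp_pos _).le.trans h1).trans (le_max_left _ _)
  have htest' : max h₁ h₂ * expUB (S * ((c P₂ - c P₁) / 2)) < θ :=
    (mul_le_mul_of_nonneg_left (expUB_mono hpad0 hpad) hh).trans_lt htest
  exact exp_lt_on_Icc_of_expUB_test hcont hder hS hS0 hab (hpad.trans hx1) h1 h2 htest' hu

/-- **THE LOWER-GUARD DECISION ON A PRESSURE SUB-INTERVAL** (linear form): `l₁ ≤ X(P₁)`,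
`l₂ ≤ X(P₂)` (`0 < l₁`, `0 < l₂`), spacing `≤ Lbar`, and `θ < min l₁ l₂ · (1 - S·Lbar/2)` ⇒
`θ < X` on `[P₁, P₂]` (e.g. `θ_hi < r₁,lo · (1 - S L/2)` keeps «1BH» decided). [folklore] -/
theorem lt_exp_on_pressure_Icc_of_linear_test {c f f' : ℝ → ℝ} {P₁ P₂ Lbar S l₁ l₂ θ P : ℝ}
    (hc : MonotoneOn c (Icc P₁ P₂)) (hL : c P₂ - c P₁ ≤ Lbar)
    (hcont : ContinuousOn f (Icc (c P₁) (c P₂)))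
    (hder : ∀ x ∈ Ioo (c P₁) (c P₂), HasDerivAt f (f' x) x)
    (hS : ∀ x ∈ Ioo (c P₁) (c P₂), |f' x| ≤ S) (hS0 : 0 ≤ S)
    (hl₁ : 0 < l₁) (hl₂ : 0 < l₂) (h1 : l₁ ≤ Real.exp (f (c P₁))) (h2 : l₂ ≤ Real.exp (f (c P₂)))
    (htest : θ < min l₁ l₂ * (1 - S * (Lbar / 2))) (hP : P ∈ Icc P₁ P₂) :
    θ < Real.exp (f (c P)) := by
  have hu : c P ∈ Icc (c P₁) (c P₂) := mem_Icc_of_monotoneOn hc hP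
  have hl : 0 ≤ min l₁ l₂ := (lt_min hl₁ hl₂).le
  have hpad : 1 - S * (Lbar / 2) ≤ 1 - S * ((c P₂ - c P₁) / 2) := by
    nlinarith [mul_le_mul_of_nonneg_left (show (c P₂ - c P₁) / 2 ≤ Lbar / 2 by linarith) hS0]
  exact lt_exp_on_Icc_of_linear_test hcont hder hS hS0 hl₁ hl₂ h1 h2
    (htest.trans_le (mul_le_mul_of_nonneg_left hpad hl)) hu

/-- **THE ONE-SIDED GUARD DECISION, reach UPWARD from the last computed point `P₁`**: `X(P₁) ≤ h`,
spacing of `[P₁, P₂]` at most `ℓbar`, `S·ℓbar ≤ 1`, and `h · expUB (S·ℓbar) < θ` ⇒ `X < θ` on the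
whole reach `[P₁, P₂]` (§P.12(c′)(iii)-BY-GUARD). [folklore] -/
theorem exp_lt_on_pressure_Icc_of_expUB_end_test {c f f' : ℝ → ℝ} {P₁ P₂ ℓbar S h θ P : ℝ}
    (hc : MonotoneOn c (Icc P₁ P₂)) (hL : c P₂ - c P₁ ≤ ℓbar)
    (hcont : ContinuousOn f (Icc (c P₁) (c P₂)))
    (hder : ∀ x ∈ Ioo (c P₁) (c P₂), HasDerivAt f (f' x) x)
    (hS : ∀ x ∈ Ioo (c P₁) (c P₂), |f' x| ≤ S) (hS0 : 0 ≤ S) (h12 : P₁ ≤ P₂)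
    (hx1 : S * ℓbar ≤ 1) (h1 : Real.exp (f (c P₁)) ≤ h) (htest : h * expUB (S * ℓbar) < θ)
    (hP : P ∈ Icc P₁ P₂) : Real.exp (f (c P)) < θ := by
  have hu : c P ∈ Icc (c P₁) (c P₂) := mem_Icc_of_monotoneOn hc hP
  have hab : c P₁ ≤ c P₂ := hc (left_mem_Icc.2 h12) (right_mem_Icc.2 h12) h12
  have hpad0 : 0 ≤ S * (c P₂ - c P₁) := mul_nonneg hS0 (by linarith)
  have hpad : S * (c P₂ - c P₁) ≤ S * ℓbar := mul_le_mul_of_nonneg_left hL hS0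
  have hh : 0 ≤ h := (Real.exp_pos _).le.trans h1
  have htest' : h * expUB (S * (c P₂ - c P₁)) < θ :=
    (mul_le_mul_of_nonneg_left (expUB_mono hpad0 hpad) hh).trans_lt htest
  exact exp_lt_on_Icc_of_expUB_end_test hcont hder hS hS0 hab (hpad.trans hx1) h1 htest' hu

/-- **THE ONE-SIDED GUARD TEST with the known value at the RIGHT end** of a log-compression
interval `[a, b]`: `X(b) ≤ h`, `|f'| ≤ S` on `(a, b)`, `S (b - a) ≤ 1`, `h · expUB (S (b - a)) < θ`
⇒ `X(u) < θ` on `[a, b]` (mirror image of `exp_lt_on_Icc_of_expUB_end_test`). [folklore] -/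
theorem exp_lt_on_Icc_of_expUB_right_end_test {f f' : ℝ → ℝ} {a b S u h θ : ℝ}
    (hcont : ContinuousOn f (Icc a b)) (hder : ∀ x ∈ Ioo a b, HasDerivAt f (f' x) x)
    (hS : ∀ x ∈ Ioo a b, |f' x| ≤ S) (hS0 : 0 ≤ S) (hab : a ≤ b) (hx1 : S * (b - a) ≤ 1)
    (hb : Real.exp (f b) ≤ h) (htest : h * expUB (S * (b - a)) < θ) (hu : u ∈ Icc a b) :
    Real.exp (f u) < θ := by
  obtain ⟨-, r⟩ := mem_Icc_of_abs_deriv_le_right hcont hder hS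
    (show f b ∈ Icc (f b) (f b) from ⟨le_rfl, le_rfl⟩) hu
  have hx0 : 0 ≤ S * (b - a) := mul_nonneg hS0 (by linarith)
  have h1 : f u ≤ f b + S * (b - a) :=
    r.trans (by linarith [mul_le_mul_of_nonneg_left (show b - u ≤ b - a by linarith [hu.1]) hS0])
  have h2 : Real.exp (f u) ≤ Real.exp (f b) * Real.exp (S * (b - a)) := by
    rw [← Real.exp_add]; exact Real.exp_le_exp.2 h1
  have hh : 0 ≤ h := (Real.exp_pos _).le.trans hb
  calc Real.exp (f u) ≤ Real.exp (f b) * Real.exp (S * (b - a)) := h2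
    _ ≤ h * Real.exp (S * (b - a)) := mul_le_mul_of_nonneg_right hb (Real.exp_pos _).le
    _ ≤ h * expUB (S * (b - a)) := mul_le_mul_of_nonneg_left (exp_le_expUB hx0 hx1) hh
    _ < θ := htest

/-- **THE ONE-SIDED GUARD DECISION, reach DOWNWARD from the first computed point `P₂`**:
`X(P₂) ≤ h`, spacing of `[P₁, P₂]` at most `ℓbar`, `S·ℓbar ≤ 1`, `h · expUB (S·ℓbar) < θ` ⇒
`X < θ` on `[P₁, P₂]`. [folklore] -/
theorem exp_lt_on_pressure_Icc_of_expUB_start_test {c f f' : ℝ → ℝ} {P₁ P₂ ℓbar S h θ P : ℝ}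
    (hc : MonotoneOn c (Icc P₁ P₂)) (hL : c P₂ - c P₁ ≤ ℓbar)
    (hcont : ContinuousOn f (Icc (c P₁) (c P₂)))
    (hder : ∀ x ∈ Ioo (c P₁) (c P₂), HasDerivAt f (f' x) x)
    (hS : ∀ x ∈ Ioo (c P₁) (c P₂), |f' x| ≤ S) (hS0 : 0 ≤ S) (h12 : P₁ ≤ P₂)
    (hx1 : S * ℓbar ≤ 1) (h2 : Real.exp (f (c P₂)) ≤ h) (htest : h * expUB (S * ℓbar) < θ)
    (hP : P ∈ Icc P₁ P₂) : Real.exp (f (c P)) < θ := by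
  have hu : c P ∈ Icc (c P₁) (c P₂) := mem_Icc_of_monotoneOn hc hP
  have hab : c P₁ ≤ c P₂ := hc (left_mem_Icc.2 h12) (right_mem_Icc.2 h12) h12
  have hpad0 : 0 ≤ S * (c P₂ - c P₁) := mul_nonneg hS0 (by linarith)
  have hpad : S * (c P₂ - c P₁) ≤ S * ℓbar := mul_le_mul_of_nonneg_left hL hS0
  have hh : 0 ≤ h := (Real.exp_pos _).le.trans h2
  have htest' : h * expUB (S * (c P₂ - c P₁)) < θ :=
    (mul_le_mul_of_nonneg_left (expUB_mono hpad0 hpad) hh).trans_lt htest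
  exact exp_lt_on_Icc_of_expUB_right_end_test hcont hder hS hS0 hab (hpad.trans hx1) h2 htest' hu

/-- **ALL-IN-ONE, MODULUS FLOOR**: a log-compression law `c` with `0 ≤ c' ≤ 1/K_min` on
`(P₁, P₂)` (`K_min > 0`), and the margin test run with `Lbar = (P₂ - P₁)/K_min` ⇒ the upper guard
holds on the whole pressure sub-interval. The only EOS input is the floor `K_min`. [folklore] -/
theorem exp_lt_on_pressure_Icc_of_modulusFloor_test {c c' f f' : ℝ → ℝ}
    {P₁ P₂ Kmin S h₁ h₂ θ P : ℝ}
    (hcc : ContinuousOn c (Icc P₁ P₂)) (hcd : ∀ Q ∈ Ioo P₁ P₂, HasDerivAt c (c' Q) Q)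
    (hK : ∀ Q ∈ Ioo P₁ P₂, 0 ≤ c' Q ∧ c' Q ≤ 1 / Kmin) (h12 : P₁ ≤ P₂)
    (hcont : ContinuousOn f (Icc (c P₁) (c P₂)))
    (hder : ∀ x ∈ Ioo (c P₁) (c P₂), HasDerivAt f (f' x) x)
    (hS : ∀ x ∈ Ioo (c P₁) (c P₂), |f' x| ≤ S) (hS0 : 0 ≤ S)
    (hx1 : S * (((P₂ - P₁) / Kmin) / 2) ≤ 1)
    (h1 : Real.exp (f (c P₁)) ≤ h₁) (h2 : Real.exp (f (c P₂)) ≤ h₂)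
    (htest : max h₁ h₂ * expUB (S * (((P₂ - P₁) / Kmin) / 2)) < θ) (hP : P ∈ Icc P₁ P₂) :
    Real.exp (f (c P)) < θ :=
  exp_lt_on_pressure_Icc_of_expUB_test
    (strain_monotoneOn_of_deriv_nonneg hcc hcd fun Q hQ => (hK Q hQ).1)
    (strain_sub_le_of_deriv_le hcc hcd (fun Q hQ => (hK Q hQ).2) h12)
    hcont hder hS hS0 h12 hx1 h1 h2 htest hP

/-- **ALL-IN-ONE, MURNAGHAN EOS OF RECORD**: along the Murnaghan isotherm with printed `(B₀, B₀')`
the margin test run with `Lbar = (P₂ - P₁)/(B₀ + B₀' P₁)` decides the upper guard on the whole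
pressure sub-interval `[P₁, P₂]` (`0 ≤ P₁ ≤ P₂`). [folklore] -/
theorem exp_lt_on_pressure_Icc_of_murnaghan_test {f f' : ℝ → ℝ} {B₀ B₀' P₁ P₂ S h₁ h₂ θ P : ℝ}
    (hB₀ : 0 < B₀) (hB : 0 < B₀') (hP₁ : 0 ≤ P₁) (h12 : P₁ ≤ P₂)
    (hcont : ContinuousOn f (Icc (murnaghanStrain B₀ B₀' P₁) (murnaghanStrain B₀ B₀' P₂)))
    (hder : ∀ x ∈ Ioo (murnaghanStrain B₀ B₀' P₁) (murnaghanStrain B₀ B₀' P₂), HasDerivAt f (f' x) x)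
    (hS : ∀ x ∈ Ioo (murnaghanStrain B₀ B₀' P₁) (murnaghanStrain B₀ B₀' P₂), |f' x| ≤ S)
    (hS0 : 0 ≤ S) (hx1 : S * (((P₂ - P₁) / (B₀ + B₀' * P₁)) / 2) ≤ 1)
    (h1 : Real.exp (f (murnaghanStrain B₀ B₀' P₁)) ≤ h₁)
    (h2 : Real.exp (f (murnaghanStrain B₀ B₀' P₂)) ≤ h₂)
    (htest : max h₁ h₂ * expUB (S * (((P₂ - P₁) / (B₀ + B₀' * P₁)) / 2)) < θ)
    (hP : P ∈ Icc P₁ P₂) : Real.exp (f (murnaghanStrain B₀ B₀' P)) < θ :=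
  exp_lt_on_pressure_Icc_of_expUB_test (murnaghanStrain_monotoneOn hB₀ hB hP₁)
    (murnaghanStrain_sub_le hB₀ hB hP₁ h12) hcont hder hS hS0 h12 hx1 h1 h2 htest hP

/-! ## §4 Rows of record re-certified from the EOS inputs they print

`router/P-INTERVALS.md` prints, per interval, the EOS of record used for `L` (REFVALS-3 §5 by source,
or the row's stated class parameters). The tests below replace the floating-point `L` of
`PressureAxisDecide` §3 by the certified one-step bound `(P₂ - P₁)/(K₀ + K′ P₁)` of §2 (or the
EOS-free floor `(P₂ - P₁)/K₀`); threshold `θ_c3 = 3/5`, class `S_(U/t) = 12/5`. The decimal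
margins printed in the rows are not changed by this; what changes is that the arithmetic from
`(K₀, K′, P₁, P₂, r_man,hi)` to the word is now kernel-checked end to end. -/

/-- **V M102 (30,60): DECIDED from the EOS inputs** (`r_man,hi` 0.45 / 0.40; Murnaghan class
`K₀ = 157 GPa`, `K′ = 7/2` ⇒ `L ≤ 30/262`): `0.45 · expUB (1.2 · 30/262) < 0.6`. [folklore] -/
theorem v_30_60_eos_test :
    max (45 / 100 : ℝ) (40 / 100) * expUB ((12 / 5) * (((60 - 30) / (157 + (7 / 2) * 30)) / 2))
      < 3 / 5 := by
  rw [max_eq_left (by norm_num)]; unfold expUB; norm_num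

/-- **V M102 (60,90): DECIDED from the EOS inputs** (`r_man,hi` 0.40 / 0.38; `L ≤ 30/367`).
[folklore] -/
theorem v_60_90_eos_test :
    max (40 / 100 : ℝ) (38 / 100) * expUB ((12 / 5) * (((90 - 60) / (157 + (7 / 2) * 60)) / 2))
      < 3 / 5 := by
  rw [max_eq_left (by norm_num)]; unfold expUB; norm_num

/-- **V M102 (90,120): DECIDED from the EOS inputs** (`r_man,hi` 0.38 / 0.35; `L ≤ 30/472`).
[folklore] -/
theorem v_90_120_eos_test :
    max (38 / 100 : ℝ) (35 / 100) * expUB ((12 / 5) * (((120 - 90) / (157 + (7 / 2) * 90)) / 2))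
      < 3 / 5 := by
  rw [max_eq_left (by norm_num)]; unfold expUB; norm_num

/-- **V M102 (0,30): WITHHELD from the EOS inputs** — with the certified LOWER spacing bound
`L ≥ 30/(157 + 3.5·30) = 30/262` (`le_murnaghanStrain_sub`) and `e^x ≥ 1 + x`, the padded hull
`0.55 · e^{1.2 L}` already reaches `0.55 · (1 + 1.2·30/262) ≥ 0.6`. [folklore] -/
theorem v_0_30_eos_padded_hull_ge :
    (3 / 5 : ℝ) ≤ 55 / 100 * Real.exp ((12 / 5) * (((30 - 0) / (157 + (7 / 2) * 30)) / 2)) := by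
  have h := Real.add_one_le_exp ((12 / 5 : ℝ) * (((30 - 0) / (157 + (7 / 2) * 30)) / 2))
  nlinarith [h]

/-- The (0,30) withholding transfers to the TRUE spacing of the class law: any `L` at least the
certified lower bound keeps the padded hull at or above the threshold. [folklore] -/
theorem v_0_30_eos_padded_hull_ge_of_le {L : ℝ} (hL : (30 - 0) / (157 + (7 / 2) * 30) ≤ L) :
    (3 / 5 : ℝ) ≤ 55 / 100 * Real.exp ((12 / 5) * (L / 2)) :=
  v_0_30_eos_padded_hull_ge.trans (mul_le_mul_of_nonneg_left
    (Real.exp_le_exp.2 (by nlinarith)) (by norm_num))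

/-- **GRID-CURE PRE-REGISTRATION V (0,10), EOS-SHAPE-FREE**: on the pre-registered guards
(`r_man,hi` 0.55 @0, 0.52 expected @10) the test passes already with the FLOOR bound `L ≤ 10/157`
valid for every law whose bulk modulus is `≥ K₀ = 157 GPa` on `[0, 10]`:
`0.55 · expUB (1.2 · 10/157) < 0.6` (= 0.5937). [folklore] -/
theorem v_0_10_floor_test :
    max (55 / 100 : ℝ) (52 / 100) * expUB ((12 / 5) * (((10 - 0) / 157) / 2)) < 3 / 5 := by
  rw [max_eq_left (by norm_num)]; unfold expUB; norm_num

/-- **Y M99 (46.6,89.3): DECIDED from the EOS inputs in ONE step** (`r_man,hi` 0.43 @46.6 (dhcp;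
fcc 0.36) / 0.24 @89.3; Murnaghan class `K₀ = 41 GPa`, `K′ = 14/5` ⇒ `L ≤ 42.7/171.48 = 0.249`;
`0.43 · expUB (1.2 · 0.249) = 0.580 < 0.6`; the row's floating value was `L = 0.189`). [folklore] -/
theorem y_46p6_89p3_eos_test :
    max (43 / 100 : ℝ) (24 / 100) *
        expUB ((12 / 5) * (((893 / 10 - 466 / 10) / (41 + (14 / 5) * (466 / 10))) / 2)) < 3 / 5 := by
  rw [max_eq_left (by norm_num)]; unfold expUB; norm_num

/-! ## §5 The secant rule: a law whose modulus does not soften (concave log-compression)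

The reaches of `router/P-ONESIDED.tsv` that have no printed EOS take the spacing rate from an OWN
secant below the last computed point («own PBE secant L(170,200) ≈ 0.05 per 30 GPa ⇒ reach ≈ 36
GPa»). That is a certified UPPER bound on the spacing beyond the point exactly when the
log-compression law is CONCAVE in `P` (its derivative `1/K` is non-increasing, i.e. the modulus
does not soften under compression) — the chord slope of a concave function decreases as the chord
moves right. A reach INSIDE a computed pair needs only monotonicity. -/

/-- **SECANT RULE.** `c` concave on `[Pa, P₂]`, an own secant over `[Pa, Pb]` at or below the last
computed point `P₁` (`Pa < Pb ≤ P₁ < P₂`): the spacing beyond `P₁` is at most the width times the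
secant rate, `c(P₂) - c(P₁) ≤ (P₂ - P₁) · (c(Pb) - c(Pa))/(Pb - Pa)`. [folklore] -/
theorem strain_sub_le_mul_slope_of_concaveOn {c : ℝ → ℝ} {Pa Pb P₁ P₂ : ℝ}
    (hc : ConcaveOn ℝ (Icc Pa P₂) c) (hab : Pa < Pb) (hb1 : Pb ≤ P₁) (h12 : P₁ < P₂) :
    c P₂ - c P₁ ≤ (P₂ - P₁) * ((c Pb - c Pa) / (Pb - Pa)) := by
  have hPa : Pa ∈ Icc Pa P₂ := left_mem_Icc.2 (by linarith)
  have hP₂ : P₂ ∈ Icc Pa P₂ := right_mem_Icc.2 (by linarith)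
  have hslope : (c P₂ - c P₁) / (P₂ - P₁) ≤ (c Pb - c Pa) / (Pb - Pa) := by
    rcases eq_or_lt_of_le hb1 with h | h
    · subst h
      exact hc.slope_anti_adjacent hPa hP₂ hab h12
    · have hPb : Pb ∈ Icc Pa P₂ := ⟨hab.le, by linarith⟩
      have hP₁ : P₁ ∈ Icc Pa P₂ := ⟨by linarith, h12.le⟩
      exact (hc.slope_anti_adjacent hPb hP₂ h h12).trans (hc.slope_anti_adjacent hPa hP₁ hab h)
  have hd : 0 < P₂ - P₁ := sub_pos.2 h12
  calc c P₂ - c P₁ = (P₂ - P₁) * ((c P₂ - c P₁) / (P₂ - P₁)) := by field_simp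
    _ ≤ (P₂ - P₁) * ((c Pb - c Pa) / (Pb - Pa)) := mul_le_mul_of_nonneg_left hslope hd.le

/-- **SECANT RULE as a spacing bound `≤ ℓbar`**: if moreover `(P₂ - P₁) · rate ≤ ℓbar` for the own
secant rate, the reach `[P₁, P₂]` has spacing `≤ ℓbar` (feed to `exp_lt_on_pressure_Icc_of_expUB_end_test`).
[folklore] -/
theorem strain_sub_le_of_concaveOn_secant {c : ℝ → ℝ} {Pa Pb P₁ P₂ ℓbar : ℝ}
    (hc : ConcaveOn ℝ (Icc Pa P₂) c) (hab : Pa < Pb) (hb1 : Pb ≤ P₁) (h12 : P₁ < P₂)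
    (hℓ : (P₂ - P₁) * ((c Pb - c Pa) / (Pb - Pa)) ≤ ℓbar) : c P₂ - c P₁ ≤ ℓbar :=
  (strain_sub_le_mul_slope_of_concaveOn hc hab hb1 h12).trans hℓ

/-- Concavity from the derivative: `c` continuous on `[Pa, P₂]` with derivative `c'` on `(Pa, P₂)`
that is ANTITONE there (modulus non-decreasing) ⇒ `c` concave on `[Pa, P₂]`. [folklore] -/
theorem strain_concaveOn_of_deriv_antitoneOn {c c' : ℝ → ℝ} {Pa P₂ : ℝ}
    (hcont : ContinuousOn c (Icc Pa P₂)) (hder : ∀ P ∈ Ioo Pa P₂, HasDerivAt c (c' P) P)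
    (hanti : AntitoneOn c' (Ioo Pa P₂)) : ConcaveOn ℝ (Icc Pa P₂) c := by
  have hdiff : DifferentiableOn ℝ c (interior (Icc Pa P₂)) := by
    rw [interior_Icc]; exact fun z hz => (hder z hz).differentiableAt.differentiableWithinAt
  refine AntitoneOn.concaveOn_of_deriv (convex_Icc Pa P₂) hcont hdiff ?_
  rw [interior_Icc]
  intro x hx y hy hxy
  rw [(hder x hx).deriv, (hder y hy).deriv]
  exact hanti hx hy hxy

/-- The Murnaghan log-compression is CONCAVE on every `[P₁, P₂]` with `P₁ ≥ 0` (its derivative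
`1/(B₀ + B₀' P)` decreases). [folklore] -/
theorem murnaghanStrain_concaveOn {B₀ B₀' P₁ P₂ : ℝ} (hB₀ : 0 < B₀) (hB : 0 < B₀') (hP₁ : 0 ≤ P₁) :
    ConcaveOn ℝ (Icc P₁ P₂) (murnaghanStrain B₀ B₀') := by
  refine strain_concaveOn_of_deriv_antitoneOn (c' := fun P => 1 / (B₀ + B₀' * P))
    (continuousOn_murnaghanStrain hB₀ hB hP₁)
    (fun P hP => hasDerivAt_murnaghanStrain hB₀ hB (hP₁.trans hP.1.le)) ?_
  intro x hx y hy hxy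
  have hx0 : 0 ≤ x := hP₁.trans hx.1.le
  have hKx : 0 < B₀ + B₀' * x := by nlinarith [mul_nonneg hB.le hx0]
  exact one_div_le_one_div_of_le hKx (by nlinarith [mul_le_mul_of_nonneg_left hxy hB.le])

/-- **REACH INSIDE A COMPUTED PAIR**: for a monotone law and `P₁ ≤ P₂ ≤ P₃` the spacing of the
partial reach `[P₁, P₂]` is at most that of the computed pair `[P₁, P₃]` (e.g. FeSe 4 → 6.2 inside
the (4, 8) pair whose interval word is withheld by a structure entry at 6.2). [folklore] -/
theorem strain_sub_le_of_monotoneOn_inside {c : ℝ → ℝ} {P₁ P₂ P₃ : ℝ}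
    (hc : MonotoneOn c (Icc P₁ P₃)) (h12 : P₁ ≤ P₂) (h23 : P₂ ≤ P₃) :
    c P₂ - c P₁ ≤ c P₃ - c P₁ :=
  sub_le_sub_right (hc ⟨h12, h23⟩ (right_mem_Icc.2 (h12.trans h23)) h23) _

/-! ### Reaches of record re-certified (`router/P-ONESIDED.tsv`; cap `ℓ ≤ 0.06`; guard test where the
row prints one). A certified reach END is `P₁ + 0.06 · K_floor(P₁)` with `K_floor` the modulus floor
the row's EOS family supplies (Murnaghan: `B₀ + B₀' P₁`; Birch–Murnaghan with `B₀' ≥ 4`: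
`B₀ + (7/3) P₁` and Vinet with `B₀' ≥ 1`: `B₀ + (2/3) P₁` by lit-3's `birchMurnaghan3_le_bulkModulus` /
`vinet_le_bulkModulus`; own secant: the secant rate, by §5). -/

/-- **Pb M02 reach 10 → 13.7 (structure cap): CERTIFIED** — BM3 box EOS `B₀ 39.8`, `B₀' 4.85 ≥ 4` ⇒
modulus floor `39.8 + (7/3)·10` on `[10, 13.7]` ⇒ spacing `≤ 3.7/63.13 < 0.06`. [folklore] -/
theorem pb_10_13p7_reach_cap : (137 / 10 - 10 : ℝ) / (398 / 10 + (7 / 3) * 10) ≤ 6 / 100 := by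
  norm_num

/-- **Lu–N–H M52c reach 1 → 6 (structure cap): CERTIFIED** — Murnaghan `K₀ 88.6`, `K′ 4`
(Hilleke 2023 restated set) ⇒ spacing `≤ 5/92.6 < 0.06`. [folklore] -/
theorem lunh_1_6_reach_cap : (6 - 1 : ℝ) / (886 / 10 + 4 * 1) ≤ 6 / 100 := by norm_num

/-- **Y M99 reach 89.3 → 100 (structure cap): CERTIFIED with the guard** — Murnaghan class
`K₀ 41`, `K′ 2.8` ⇒ `ℓ ≤ 10.7/291.04`; `r_man,hi 0.24 · expUB (2.4 ℓ) < 0.6`. [folklore] -/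
theorem y_89p3_100_reach_test :
    (24 / 100 : ℝ) * expUB ((12 / 5) * ((100 - 893 / 10) / (41 + (14 / 5) * (893 / 10)))) < 3 / 5 := by
  unfold expUB; norm_num

/-- **CaH₆ M10 reach 170 → 160 DOWNWARD: CERTIFIED by the EOS-free floor** — any law with
`K ≥ B₀ = 221 GPa` (Li 2022 fit, REFVALS-3 v1.50 §5) on `[160, 170]` has spacing `≤ 10/221 < 0.06`
(the own secant from ABOVE is not a bound for a downward reach; the floor is). [folklore] -/
theorem cah6_160_170_reach_cap : (170 - 160 : ℝ) / 221 ≤ 6 / 100 := by norm_num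

end Inflation

end Summit.Ventures.CertifiedManyBodySolver.Downfold
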